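import Mathlib
import Summits.Ventures.PercRepro2.SharpHalves

/-!
# The `L`-half is bounded below by its `T`-part (blind cell PercRepro2, night-1 g35)

`SharpHalves.sharp_identity` splits `P(T) P(R) · ΓLc` into the two worlds `T = Q ∩ {a₃ ∈ H}`,
`R = Q ∩ {a₃ ∉ H}`: `SL = P(R) · Tpart + P(T) · Rpart` with
`Tpart = P(T,bL,oL) P(T) − P(T,bL) P(T,oL)` (the membership-conditioned covariance, of either sign) and
`Rpart = P(R,bL) P(R,oH) − P(R,bL,oH) P(R)` (the avoidance-conditioned BHK slack).

* **`Rpart_nonneg`**: `0 ≤ Rpart` (`bhk_cross_cluster_avoid` with `s = a₂`, `t = a₁`, `X = {a₁, a₃}`);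
* **`GammaLc_ge_Tpart`**: `P(T) P(R) · ΓLc ≥ 2 [D P(Q) P(R) · Tpart + B · X]` with the two nonnegative
  brackets `B = D_o P(T) P(R) − D P(T,oL) P(R) − D P(R,oH) P(T)` (`centring_bracket_nonneg`) and
  `X = P(Q,bL) P(T) − P(T,bL) P(Q)` (`TbL_mul_Q_le`).

So HALF-L (`0 ≤ ΓLc`) can fail only through `Tpart < 0`, and holds as soon as
`D P(Q) P(R) · Tpart + B · X ≥ 0`; the kit adversary finds no instance where it fails (night-1 g35).
-/

namespace Summit.Ventures.PercRepro2

namespace SharpHalves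

open CovForm SideBridge

variable {V : Type*} {E : Type*} [Fintype E] [DecidableEq E] [Fintype V] [DecidableEq V]
  {R : Type*} [Field R] [LinearOrder R] [IsStrictOrderedRing R]

variable (p : E → R) (ends : E → Sym2 V) (o a₁ a₂ a₃ b : V)

omit [Fintype E] [DecidableEq E] [Fintype V] [LinearOrder R] [IsStrictOrderedRing R] in
/-- `{oH} ∩ {bL} ∩ R` through the clusters. -/
lemma e_R_oHbL : clusterInEvent ends a₂ {W : Set V | o ∈ W} ∩
    clusterInEvent ends a₁ {W : Set V | b ∈ W} ∩ avoidAll ends a₂ {a₁, a₃} =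
      avoidAll ends a₂ {a₁, a₃} ∩ (connEvent ends a₂ o ∩ connEvent ends a₁ b) := by
  ext ω
  simp only [Set.mem_inter_iff, mem_clusterInEvent, Set.mem_setOf_eq, mem_cluster, mem_connEvent]
  tauto

omit [Fintype E] [DecidableEq E] [Fintype V] [LinearOrder R] [IsStrictOrderedRing R] in
/-- `{oH} ∩ R` through the clusters. -/
lemma e_R_oH : clusterInEvent ends a₂ {W : Set V | o ∈ W} ∩ avoidAll ends a₂ {a₁, a₃} =
    avoidAll ends a₂ {a₁, a₃} ∩ connEvent ends a₂ o := by
  ext ω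
  simp only [Set.mem_inter_iff, mem_clusterInEvent, Set.mem_setOf_eq, mem_cluster, mem_connEvent]
  tauto

omit [Fintype E] [DecidableEq E] [Fintype V] [LinearOrder R] [IsStrictOrderedRing R] in
/-- `{bL} ∩ R` through the clusters. -/
lemma e_R_bL : clusterInEvent ends a₁ {W : Set V | b ∈ W} ∩ avoidAll ends a₂ {a₁, a₃} =
    avoidAll ends a₂ {a₁, a₃} ∩ connEvent ends a₁ b := by
  ext ω
  simp only [Set.mem_inter_iff, mem_clusterInEvent, Set.mem_setOf_eq, mem_cluster, mem_connEvent]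
  tauto

/-- **The `R`-part of `SL` is a BHK slack**: `P(R,bL,oH) P(R) ≤ P(R,bL) P(R,oH)`
(`bhk_cross_cluster_avoid`: `bL` and `oH` under the avoidance `a₂ ↮ {a₁, a₃}`). -/
theorem Rpart_nonneg (hp : IsProbVec p) :
    prob p (avoidAll ends a₂ {a₁, a₃} ∩ (connEvent ends a₂ o ∩ connEvent ends a₁ b)) *
        prob p (avoidAll ends a₂ {a₁, a₃}) ≤
      prob p (avoidAll ends a₂ {a₁, a₃} ∩ connEvent ends a₁ b) *
        prob p (avoidAll ends a₂ {a₁, a₃} ∩ connEvent ends a₂ o) := by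
  have h := bhk_cross_cluster_avoid p hp ends a₂ a₁ (X := {a₁, a₃}) (Finset.mem_insert_self a₁ {a₃})
    (isUpperSet_mem_setOf o) (isUpperSet_mem_setOf b)
  rw [e_R_oHbL, e_R_oH, e_R_bL] at h
  linarith [h]

/-- **`ΓLc` is bounded below by its `T`-part**:
`P(T) P(R) · ΓLc ≥ 2 [D P(Q) P(R) · Tpart + B · X]`, `Tpart = P(T,bL,oL) P(T) − P(T,bL) P(T,oL)`. -/
theorem GammaLc_ge_Tpart (hp : IsProbVec p) :
    2 * (prob p (PDEvent ends a₁ a₂ a₃) * prob p (avoidAll ends a₂ {a₁}) *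
          prob p (avoidAll ends a₂ {a₁, a₃}) *
          (prob p (TEvent ends a₁ a₂ a₃ ∩ (connEvent ends a₁ o ∩ connEvent ends a₁ b)) *
              prob p (TEvent ends a₁ a₂ a₃) -
            prob p (TEvent ends a₁ a₂ a₃ ∩ connEvent ends a₁ b) *
              prob p (TEvent ends a₁ a₂ a₃ ∩ connEvent ends a₁ o)) +
        (Do p ends o a₁ a₂ a₃ * prob p (TEvent ends a₁ a₂ a₃) * prob p (avoidAll ends a₂ {a₁, a₃}) -
            prob p (PDEvent ends a₁ a₂ a₃) * prob p (TEvent ends a₁ a₂ a₃ ∩ connEvent ends a₁ o) *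
              prob p (avoidAll ends a₂ {a₁, a₃}) -
            prob p (PDEvent ends a₁ a₂ a₃) *
              prob p (avoidAll ends a₂ {a₁, a₃} ∩ connEvent ends a₂ o) *
              prob p (TEvent ends a₁ a₂ a₃)) *
          (prob p (avoidAll ends a₂ {a₁} ∩ connEvent ends a₁ b) * prob p (TEvent ends a₁ a₂ a₃) -
            prob p (TEvent ends a₁ a₂ a₃ ∩ connEvent ends a₁ b) *
              prob p (avoidAll ends a₂ {a₁}))) ≤
      prob p (TEvent ends a₁ a₂ a₃) * prob p (avoidAll ends a₂ {a₁, a₃}) *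
        GammaLc p ends o a₁ a₂ a₃ b := by
  rw [sharp_identity]
  unfold SL
  have hR := Rpart_nonneg p ends o a₁ a₂ a₃ b hp
  have hD := prob_nonneg hp (PDEvent ends a₁ a₂ a₃)
  have hQ := prob_nonneg hp (avoidAll ends a₂ {a₁})
  have hT := prob_nonneg hp (TEvent ends a₁ a₂ a₃)
  have h3 : 0 ≤ prob p (PDEvent ends a₁ a₂ a₃) * prob p (avoidAll ends a₂ {a₁}) *
      prob p (TEvent ends a₁ a₂ a₃) *
      (prob p (avoidAll ends a₂ {a₁, a₃} ∩ connEvent ends a₁ b) *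
          prob p (avoidAll ends a₂ {a₁, a₃} ∩ connEvent ends a₂ o) -
        prob p (avoidAll ends a₂ {a₁, a₃} ∩ (connEvent ends a₂ o ∩ connEvent ends a₁ b)) *
          prob p (avoidAll ends a₂ {a₁, a₃})) :=
    mul_nonneg (mul_nonneg (mul_nonneg hD hQ) hT) (sub_nonneg.mpr hR)
  nlinarith [h3]

end SharpHalves

end Summit.Ventures.PercRepro2
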